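import Summits.CriticalPhenomena.PercolationContinuityZ3.Theorems.Transplant.KNLevelsKitsForced
import Literature.Probability.Percolation.Crossings
import Literature.Probability.LatticeModels.ProdBernoulliCoupling
import HarnessLib

/-!
# F6/F7 (generic), (S0) kit tier part 3 — STEP IV″: the RELAY CLAUSE of a FORCED kit (Markov over the shell pairs + the rank-truncation bound;
# NO avoidance row) (N2-SCOPE §19.1 (d); T4-S0 v1.1 §4/§10 (O3); located items (O8) p5-g14, (O9) p1-g16/p5-g14)

builds on p205010 (kernel theorem, internal audit signed; external expert review pending) — nothing in this file uses p205010; nothing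
here is a claim about the open node `SamePDropOfSkeletonFrm₁`.
Lane `prim-bschramm`, seat `prim-bschramm-p1` (gen 16; (S0) kit tier, WAVE 0 (d)); helper file (`--supports stmt-CriticalPhenomena-4575`).

THE STATEMENT (`KNLevels.relayClause_of_forced`).  Seed data `σ` with the Step-III axioms at level `j`, a shell `S ⊆ B⟨j⟩ ∩ D` containing the
faces, and for every candidate contact `x` EITHER a face vertex in the target (far contacts; Kozma–Nitzan's edge-contact remedy) OR the FORCED
datum: the seed pairs INSIDE `S`, when open, join every two vertices of the (nonempty) face inside `D` (for the (S0) kit: the face is the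
vertex set of a graph ball all of whose induced edges are seed edges), and a ROUTE `1 − δ³ ≤ P(linkIn Qt (face x) Ft)`, `Ft ⊆ T`, `Qt ⊆ D`.
THEN the relay clause of part 1 holds at accuracy `δ`: `P(≥ N contacts ∧ 𝒢) − 3δ ≤ P(⋃_x oSeed_x ∩ Good_x)`.
THE PROOF (KN p. 21 "(21) ⟹ (24)" with the seed box forced, and the correction (O9)).  For a contact `x` with the forced datum let
`F′_x := E(S) ∖ seed x` and `bad_x := {ω : P_{pin F′_x, ω}(R_x) ≤ 1 − δ}` (`R_x` the route event); Kozma–Nitzan's pinned Markov bound gives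
`P(bad_x) ≤ δ³/δ = δ²`, and OFF `bad_x` an open seed makes every face vertex a good relay of the FULL pattern `ω|_{E(S)}` (the extra pinned pairs
are seed pairs, open: monotonicity of the increasing route event in the weights; inside the cylinder the forced pairs join the face to the route).
The events `bad_x` and "earlier-ranked picked seeds closed" are correlated (both read the other boxes' pairs — (O8): the route regions are centred
prisms), so instead of `P(F_x ∩ bad_x) = P(F_x)P(bad_x)` one conditions on the contact set `κ` and uses only that `SeedOpen_x` is independent of
everything else: `P(B_κ ∩ F_x ∩ bad_x) ≤ q_x · P(B_κ) · min(Π_{x′ ≺ x}(1 − q_{x′}), δ²)`, `q_x := P(SeedOpen_x)`; the ARITHMETIC LEMMA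
`Σ_i q_i · min(Π_{i′ ≺ i}(1 − q_{i′}), m) ≤ 2√m` (§1) sums this to `2δ · P(B_κ)`, and `Σ_κ P(B_κ) ≤ 1`. [cite: KozmaNitzan2024, §4 Lemma 10, pp. 19–21 (Step III (19), Step IV (21)–(25))] [cite: GrimmettPercolation1999, §2.2, §7.2] [this work]
-/

noncomputable section

open MeasureTheory ProbabilityTheory
open scoped ENNReal

namespace Summit.CriticalPhenomena.PercolationContinuityZ3.Theorems

namespace Transplant

namespace KNLevels

open Literature.Probability.Percolation Literature.Probability.LatticeModels SimpleGraph

/-! ## §1 The rank-truncation bound -/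

/-- `q ≤ 2 (1 − √(1 − q))` for `q ∈ [0, 1]`. [folklore] -/
theorem le_two_mul_one_sub_sqrt {q : ℝ} (hq0 : 0 ≤ q) (hq1 : q ≤ 1) : q ≤ 2 * (1 - Real.sqrt (1 - q)) := by
  have h : Real.sqrt (1 - q) ≤ 1 - q / 2 := by
    rw [Real.sqrt_le_left (by linarith)]
    nlinarith
  linarith

/-- **The rank-truncation bound.**  For a finite set `s` with an injective rank `r`, weights `q_x ∈ [0, 1]` and `m ≥ 0`:
`Σ_{x ∈ s} q_x · min(Π_{x′ ∈ s, r x′ < r x} (1 − q_{x′}), m) ≤ 2√m`.  (The product `P_x` is the probability that no earlier-ranked seed is open;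
`min(P, m) ≤ √(P m)` and `q_x √P_x ≤ 2(√P_x − √P_{x⁺})` telescope.  Proof here: induction on the rank-minimal element.) [this work] -/
theorem sum_mul_min_prod_le {α : Type*} [DecidableEq α] (r : α → ℕ) (q : α → ℝ) (s : Finset α)
    (hr : Set.InjOn r ↑s) (hq0 : ∀ x ∈ s, 0 ≤ q x) (hq1 : ∀ x ∈ s, q x ≤ 1) {m : ℝ} (hm : 0 ≤ m) :
    ∑ x ∈ s, q x * min (∏ x' ∈ s.filter (fun x' => r x' < r x), (1 - q x')) m ≤ 2 * Real.sqrt m := by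
  induction s using Finset.induction_on_min_value r generalizing m with
  | empty => simp [Real.sqrt_nonneg]
  | insert a s has hmin ih =>
    have hra : ∀ x ∈ s, r a < r x := fun x hx => lt_of_le_of_ne (hmin x hx) fun h => has (by
      have := hr (Finset.mem_coe.2 (Finset.mem_insert_self a s)) (Finset.mem_coe.2 (Finset.mem_insert_of_mem hx)) h
      rwa [this])
    have hrs : Set.InjOn r ↑s := hr.mono (Finset.coe_subset.2 (Finset.subset_insert a s))
    have hq0s : ∀ x ∈ s, 0 ≤ q x := fun x hx => hq0 x (Finset.mem_insert_of_mem hx)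
    have hq1s : ∀ x ∈ s, q x ≤ 1 := fun x hx => hq1 x (Finset.mem_insert_of_mem hx)
    have hqa0 : 0 ≤ q a := hq0 a (Finset.mem_insert_self a s)
    have hqa1 : q a ≤ 1 := hq1 a (Finset.mem_insert_self a s)
    -- the filters over `insert a s`
    have hfa : (insert a s).filter (fun x' => r x' < r a) = ∅ := by
      refine Finset.filter_eq_empty_iff.2 fun x hx hlt => ?_
      rcases Finset.mem_insert.1 hx with rfl | hx
      · exact lt_irrefl _ hlt
      · exact lt_asymm hlt (hra x hx)
    have hfx : ∀ x ∈ s, (insert a s).filter (fun x' => r x' < r x) = insert a (s.filter fun x' => r x' < r x) := by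
      intro x hx
      rw [Finset.filter_insert, if_pos (hra x hx)]
    have hprod : ∀ x ∈ s, ∏ x' ∈ (insert a s).filter (fun x' => r x' < r x), (1 - q x') =
        (1 - q a) * ∏ x' ∈ s.filter (fun x' => r x' < r x), (1 - q x') := by
      intro x hx
      rw [hfx x hx, Finset.prod_insert (fun h => has (Finset.mem_filter.1 h).1)]
    rw [Finset.sum_insert has, hfa, Finset.prod_empty,
      Finset.sum_congr rfl fun x hx => by rw [hprod x hx]]
    have hsm : 0 ≤ Real.sqrt m := Real.sqrt_nonneg m
    have h1m : min 1 m ≤ Real.sqrt m := by   -- (`min 1 m ≤ √m`; cf. `GRHTwistedPrimeSum.min_one_le_sqrt`)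
      rcases le_or_gt m 1 with h | h
      · refine (min_le_right _ _).trans ?_
        rw [Real.le_sqrt hm hm]; nlinarith
      · exact (min_le_left _ _).trans (Real.one_le_sqrt.2 h.le)
    -- the case `q a = 1`: all later terms vanish
    rcases eq_or_lt_of_le hqa1 with hqa | hqa
    · have hzero : ∑ x ∈ s, q x * min ((1 - q a) * ∏ x' ∈ s.filter (fun x' => r x' < r x), (1 - q x')) m = 0 := by
        refine Finset.sum_eq_zero fun x _ => ?_
        rw [hqa, sub_self, zero_mul, min_eq_left hm, mul_zero]
      rw [hzero, add_zero, hqa, one_mul]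
      linarith
    -- the case `q a < 1`: rescale `m` by `c := 1 − q a` and use the induction hypothesis
    set c : ℝ := 1 - q a with hc
    have hc0 : 0 < c := by rw [hc]; linarith
    have hresc : ∀ x ∈ s, q x * min (c * ∏ x' ∈ s.filter (fun x' => r x' < r x), (1 - q x')) m =
        c * (q x * min (∏ x' ∈ s.filter (fun x' => r x' < r x), (1 - q x')) (m / c)) := by
      intro x _
      have : min (c * ∏ x' ∈ s.filter (fun x' => r x' < r x), (1 - q x')) m =
          c * min (∏ x' ∈ s.filter (fun x' => r x' < r x), (1 - q x')) (m / c) := by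
        rw [mul_min_of_nonneg _ _ hc0.le, mul_div_cancel₀ _ hc0.ne']
      rw [this]; ring
    rw [Finset.sum_congr rfl hresc, ← Finset.mul_sum]
    have hIH := ih hrs hq0s hq1s (m := m / c) (div_nonneg hm hc0.le)
    have hcm : c * Real.sqrt (m / c) = Real.sqrt c * Real.sqrt m := by
      have e1 : c = Real.sqrt c * Real.sqrt c := (Real.mul_self_sqrt hc0.le).symm
      have e2 : Real.sqrt (m / c) = Real.sqrt m / Real.sqrt c := Real.sqrt_div' m hc0.le
      have hsc : Real.sqrt c ≠ 0 := (Real.sqrt_pos.2 hc0).ne'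
      rw [e2]; nth_rewrite 1 [e1]; field_simp
    have hsq : q a + 2 * Real.sqrt c ≤ 2 := by
      have := le_two_mul_one_sub_sqrt hqa0 hqa1
      rw [hc]; linarith
    calc q a * min 1 m + c * ∑ x ∈ s, q x * min (∏ x' ∈ s.filter (fun x' => r x' < r x), (1 - q x')) (m / c)
        ≤ q a * Real.sqrt m + c * (2 * Real.sqrt (m / c)) :=
          add_le_add (mul_le_mul_of_nonneg_left h1m hqa0) (mul_le_mul_of_nonneg_left hIH hc0.le)
      _ = Real.sqrt m * (q a + 2 * Real.sqrt c) := by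
          rw [show c * (2 * Real.sqrt (m / c)) = 2 * (c * Real.sqrt (m / c)) by ring, hcm]; ring
      _ ≤ Real.sqrt m * 2 := mul_le_mul_of_nonneg_left hsq hsm
      _ = 2 * Real.sqrt m := mul_comm _ _

/-! ## §2 The relay clause of a forced kit -/

section Forced

variable {V : Type} [DecidableEq V] {G : SimpleGraph V} [G.LocallyFinite]

omit [DecidableEq V] [G.LocallyFinite] in
/-- A face vertex in the target (and in `D`) makes the good-relay event sure (`δ > 0`): the trivial path. (The far-contact / face-in-target
remedy, pointwise form of N1's `hIV_of_mem_face`.) [folklore] -/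
theorem mem_goodFace_of_mem_target {W : Sym2 V → unitInterval} {σ : SData V} {S T D : Finset V} {δ : ℝ} (hδ : 0 < δ) {x u : V}
    (hu : u ∈ σ.face x) (huT : u ∈ T) (huD : u ∈ D) (ω : BondConfig V) : ω ∈ GoodFace W σ S T D δ x := by
  refine ⟨u, hu, ?_⟩
  have hsub : (Set.univ : Set (BondConfig V)) ⊆ ⋃ t ∈ T, openConnIn (↑D : Set V) u t := fun ω' _ =>
    Set.mem_biUnion (Finset.mem_coe.2 huT) (DCT16.mem_openConnIn_iff_pathIn.2 (PathIn.refl (Finset.mem_coe.2 huD)))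
  have h1 : (1 : ℝ) ≤ (prodBernoulli (pinW W (wireSet (↑S : Set V)) ω)).real (⋃ t ∈ T, openConnIn (↑D : Set V) u t) := by
    have := measureReal_mono (μ := prodBernoulli (pinW W (wireSet (↑S : Set V)) ω)) hsub (measure_ne_top _ _)
    rwa [probReal_univ] at this
  linarith

omit [DecidableEq V] [G.LocallyFinite] in
/-- The route event `linkIn` is increasing (local copy of `KNLevels.isUpperSet_linkIn`, `SamePInputsOpen`). [folklore] -/
private theorem isUpperSet_linkIn' (U : Set V) (S T : Finset V) : IsUpperSet (linkIn U S T) := by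
  rw [linkIn_eq_biUnion]
  exact isUpperSet_iUnion₂ fun s _ => isUpperSet_iUnion₂ fun t _ => isUpperSet_openConnIn U s t

open Classical in
/-- **STEP IV″ — THE RELAY CLAUSE OF A FORCED KIT.**  Seed data `σ` with the Step-III axioms at level `j` of `L`, a shell `S ⊆ B⟨j⟩ ∩ D`
containing the faces, `0 < δ`, and for every candidate contact EITHER a face vertex in the target OR the forced datum — the face is nonempty,
the seed pairs inside `S`, when open, join every two face vertices inside `D`, and a route `1 − δ³ ≤ P_W(linkIn Qt (face x) Ft)` with `Ft ⊆ T`,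
`Qt ⊆ D`.  THEN `RelayClause L W j σ S T D δ`: `P_W(≥ N contacts ∧ 𝒢) − 3δ ≤ P_W(⋃_x oSeed_x ∩ Good_x)`.  No avoidance row, no zone, no exit
piece. [cite: KozmaNitzan2024, §4 Lemma 10, pp. 19–21 (Step III–IV)] [this work] -/
theorem relayClause_of_forced [Countable V] {L : LData G} {W : Sym2 V → unitInterval} {σ : SData V} {j : ℕ} (hσ : SHyp L j σ)
    {S T D : Finset V} (hSX : S ⊆ L.X j) (hSD : S ⊆ D) (hUS : ∀ x ∈ σ.K, σ.face x ⊆ S) {δ : ℝ} (hδ : 0 < δ)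
    (hcon : ∀ x ∈ σ.K, (∃ u ∈ σ.face x, u ∈ T) ∨
      ((σ.face x).Nonempty ∧
        (∀ ω : BondConfig V, (∀ e ∈ σ.seed x, e ∈ wireSet (↑S : Set V) → e ∈ ω) →
          ∀ u ∈ σ.face x, ∀ v ∈ σ.face x, ω ∈ openConnIn (↑D : Set V) u v) ∧
        ∃ Qt Ft : Finset V, Ft ⊆ T ∧ Qt ⊆ D ∧ 1 - δ ^ 3 ≤ (prodBernoulli W).real (linkIn (↑Qt : Set V) (σ.face x) Ft))) :
    RelayClause L W j σ S T D δ := by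
  set μ := prodBernoulli W with hμ
  unfold RelayClause
  set Good : V → Set (BondConfig V) := fun x => GoodFace W σ S T D δ x with hGood
  set E : Set (BondConfig V) := ⋃ x ∈ σ.K, (L.oSeed σ j x ∩ Good x) with hE
  have hEm : MeasurableSet E :=
    Finset.measurableSet_biUnion _ fun x _ => (LData.measurableSet_oSeed j x).inter (measurableSet_goodFace W σ S T D δ x)
  -- it suffices to bound the measure of `(Failᶜ ∩ 𝒢) ∖ E` by `2δ`
  have hsplit : μ.real ((L.Fail σ.N j)ᶜ ∩ L.Gev σ j) ≤ μ.real E + μ.real (((L.Fail σ.N j)ᶜ ∩ L.Gev σ j) \ E) := by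
    rw [← measureReal_inter_add_sdiff (s := (L.Fail σ.N j)ᶜ ∩ L.Gev σ j) hEm]
    exact add_le_add (measureReal_mono Set.inter_subset_right (measure_ne_top _ _)) le_rfl
  suffices hmain : μ.real (((L.Fail σ.N j)ᶜ ∩ L.Gev σ j) \ E) ≤ 2 * δ by
    show (prodBernoulli W).real ((L.Fail σ.N j)ᶜ ∩ L.Gev σ j) - 3 * δ ≤ (prodBernoulli W).real E
    rw [← hμ]; linarith
  -- notation: contact-set events, seed events, the "no earlier open picked seed" events
  set Bκ : Finset V → Set (BondConfig V) := fun κ => {ω | L.Kont j ω = κ} with hBκ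
  set A : V → Set (BondConfig V) := fun x => σ.SeedOpen x with hA
  set q : V → ℝ := fun x => μ.real (A x) with hq
  set r : V → ℕ := rank σ.K with hr
  set Nκ : Finset V → V → Set (BondConfig V) := fun κ x =>
    ⋂ x' ∈ (σ.pick κ).filter (fun x' => r x' < r x), (σ.SeedOpen x')ᶜ with hNκ
  set P : Finset V → V → ℝ := fun κ x => ∏ x' ∈ (σ.pick κ).filter (fun x' => r x' < r x), (1 - q x') with hP
  set Ks := σ.K.powerset.filter (fun κ => σ.N ≤ κ.card) with hKs
  -- basic facts about `Bκ`
  have hBdet : ∀ κ, DeterminedBy (Bκ κ) (wireSet (L.region j)) := by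
    intro κ; rw [determinedBy_iff]; intro ω ω' hω
    have h1 : ∀ e ∈ wireSet (L.region j), e ∈ ω ↔ e ∈ ω' := fun e he => by
      have := Set.ext_iff.1 hω e; simp only [Set.mem_inter_iff] at this
      exact ⟨fun h' => (this.1 ⟨h', he⟩).1, fun h' => (this.2 ⟨h', he⟩).1⟩
    simp only [hBκ, Set.mem_setOf_eq, LData.Kont_congr h1]
  have hBm : ∀ κ, MeasurableSet (Bκ κ) := fun κ =>
    ((hBdet κ).mono fun _ he => Finset.mem_coe.2 (L.mem_pairsF_of_mem_wireSet_region he)).measurableSet_of_finset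
  -- region pairs avoid every seed (each seed pair has an endpoint in `B⟨j⟩`) and every pair inside `S ⊆ B⟨j⟩`
  have hreg_seed : ∀ x ∈ σ.K, wireSet (L.region j) ⊆ (↑(σ.seed x) : Set (Sym2 V))ᶜ := by
    intro x hx e he hex
    obtain ⟨z, hz, hzX⟩ := hσ.touch x hx e (Finset.mem_coe.1 hex)
    exact ((mk_mem_wireSet_iff.1 (show s(z, Sym2.Mem.other hz) ∈ wireSet (L.region j) by
      rwa [Sym2.other_spec hz])).1).1 (Finset.mem_coe.2 hzX)
  have hreg_S : ∀ F' : Finset (Sym2 V), F' ⊆ pairsF S → wireSet (L.region j) ⊆ (↑F' : Set (Sym2 V))ᶜ := by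
    intro F' hF' e he heF
    have heS : e ∈ wireSet (↑S : Set V) := by rw [← coe_pairsF]; exact Finset.mem_coe.2 (hF' (Finset.mem_coe.1 heF))
    induction e using Sym2.ind with
    | h a b =>
      have ha := (mk_mem_wireSet_iff.1 he).1
      have haS := (mk_mem_wireSet_iff.1 heS).1
      exact ha.1 (Finset.mem_coe.2 (hSX (Finset.mem_coe.1 haS)))
  -- the covering: on `(Failᶜ ∩ 𝒢) ∖ E` the first open picked seed has no good relay
  have hcov : ((L.Fail σ.N j)ᶜ ∩ L.Gev σ j) \ E ⊆ ⋃ κ ∈ Ks, ⋃ x ∈ σ.pick κ, (Bκ κ ∩ A x ∩ Nκ κ x ∩ (Good x)ᶜ) := by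
    rintro ω ⟨⟨hFail, hGev⟩, hωE⟩
    set κ := L.Kont j ω with hκdef
    have hκK : κ ⊆ σ.K := hσ.Kont_sub ω
    have hκN : σ.N ≤ κ.card := by
      simp only [LData.Fail, Set.mem_compl_iff, Set.mem_setOf_eq, not_lt] at hFail; exact hFail
    rw [← LData.biUnion_Fx_eq_Gev] at hGev
    simp only [Set.mem_iUnion, exists_prop] at hGev
    obtain ⟨x, hxK, hFx⟩ := hGev
    rw [LData.mem_Fx_iff] at hFx
    obtain ⟨hoSeed, hfirst⟩ := hFx
    have hsel : x ∈ σ.pick κ := (LData.mem_oSeed_iff.1 hoSeed).1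
    have hAx : ω ∈ A x := (LData.mem_oSeed_iff.1 hoSeed).2
    simp only [Set.mem_iUnion, exists_prop]
    refine ⟨κ, Finset.mem_filter.2 ⟨Finset.mem_powerset.2 hκK, hκN⟩, x, hsel, ⟨⟨rfl, hAx⟩, ?_⟩, fun hg => hωE ?_⟩
    · simp only [hNκ, Set.mem_iInter, Set.mem_compl_iff]
      intro x' hx' hopen
      obtain ⟨hx'sel, hlt⟩ := Finset.mem_filter.1 hx'
      exact hfirst x' (hκK (hσ.pick_sub κ hx'sel)) hlt (LData.mem_oSeed_iff.2 ⟨hx'sel, hopen⟩)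
    · exact Set.mem_biUnion (Finset.mem_coe.2 hxK) ⟨hoSeed, hg⟩
  -- the per-contact bound
  have hterm : ∀ κ ∈ Ks, ∀ x ∈ σ.pick κ,
      μ.real (Bκ κ ∩ A x ∩ Nκ κ x ∩ (Good x)ᶜ) ≤ μ.real (Bκ κ) * (q x * min (P κ x) (δ ^ 2)) := by
    intro κ hκ x hxsel
    obtain ⟨hκK, hκN⟩ := Finset.mem_filter.1 hκ
    rw [Finset.mem_powerset] at hκK
    have hxK : x ∈ σ.K := hκK (hσ.pick_sub κ hxsel)
    have hP0 : 0 ≤ P κ x := Finset.prod_nonneg fun x' _ => by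
      simp only [hq]; linarith [measureReal_le_one (μ := μ) (s := A x')]
    have hRHS0 : 0 ≤ μ.real (Bκ κ) * (q x * min (P κ x) (δ ^ 2)) :=
      mul_nonneg measureReal_nonneg (mul_nonneg measureReal_nonneg (le_min hP0 (sq_nonneg δ)))
    rcases hcon x hxK with ⟨u, hu, huT⟩ | ⟨hne, hbox, Qt, Ft, hFtT, hQtD, h3⟩
    · -- a face vertex in the target: the good-relay event is sure, the term vanishes
      have hempty : Bκ κ ∩ A x ∩ Nκ κ x ∩ (Good x)ᶜ = ∅ := Set.eq_empty_of_forall_notMem fun ω hω =>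
        hω.2 (mem_goodFace_of_mem_target hδ hu huT (hSD (hUS x hxK hu)) ω)
      rw [hempty, measureReal_empty]; exact hRHS0
    -- the forced datum
    obtain ⟨u₀, hu₀⟩ := hne
    set R : Set (BondConfig V) := linkIn (↑Qt : Set V) (σ.face x) Ft with hRdef
    have hRm : MeasurableSet R := measurableSet_linkIn Qt (σ.face x) Ft
    have hRup : IsUpperSet R := isUpperSet_linkIn' (↑Qt : Set V) (σ.face x) Ft
    set F' : Finset (Sym2 V) := pairsF S \ σ.seed x with hF'def
    have hF'S : F' ⊆ pairsF S := Finset.sdiff_subset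
    set Bad : Set (BondConfig V) := pinLow W (↑F' : Set (Sym2 V)) R δ with hBadDef
    have hBadF' : DeterminedBy Bad (↑F' : Set (Sym2 V)) := determinedBy_pinLow W _ R δ
    have hBadm : MeasurableSet Bad := hBadF'.measurableSet_of_finset
    -- (b1) an open seed off `Bad` gives a good relay
    have hgood : A x ∩ (Good x)ᶜ ⊆ A x ∩ Bad := by
      rintro ω ⟨hωA, hωG⟩
      refine ⟨hωA, ?_⟩
      by_contra hωB
      apply hωG
      rw [mem_pinLow_iff, not_le] at hωB
      refine ⟨u₀, hu₀, ?_⟩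
      -- the full pin dominates the partial pin on the increasing route event
      have hle : pinW W (↑F' : Set (Sym2 V)) ω ≤ pinW W (wireSet (↑S : Set V)) ω := by
        intro e
        by_cases heF' : e ∈ (↑F' : Set (Sym2 V))
        · have heS : e ∈ wireSet (↑S : Set V) := by
            rw [← coe_pairsF]; exact Finset.mem_coe.2 (hF'S (Finset.mem_coe.1 heF'))
          by_cases heω : e ∈ ω
          · rw [pinW_apply_of_mem_of_mem W heF' heω, pinW_apply_of_mem_of_mem W heS heω]
          · rw [pinW_apply_of_mem_of_not_mem W heF' heω, pinW_apply_of_mem_of_not_mem W heS heω]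
        · rw [pinW_apply_of_not_mem W ω heF']
          by_cases heS : e ∈ wireSet (↑S : Set V)
          · -- a pair inside `S` outside `F'` is a seed pair, hence open
            have heseed : e ∈ σ.seed x := by
              by_contra hne'
              exact heF' (Finset.mem_coe.2 (Finset.mem_sdiff.2 ⟨by rw [← Finset.mem_coe, coe_pairsF]; exact heS, hne'⟩))
            rw [pinW_apply_of_mem_of_mem W heS (hωA (Finset.mem_coe.2 heseed))]
            exact unitInterval.le_one _
          · rw [pinW_apply_of_not_mem W ω heS]
      have h1 : (prodBernoulli (pinW W (↑F' : Set (Sym2 V)) ω)).real R ≤ (prodBernoulli (pinW W (wireSet (↑S : Set V)) ω)).real R :=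
        prodBernoulli_real_mono_of_isUpperSet hle hRup hRm
      -- inside the cylinder of `ω` on `E(S)` the forced pairs join `u₀` to the route
      have h2 : (prodBernoulli (pinW W (wireSet (↑S : Set V)) ω)).real R ≤
          (prodBernoulli (pinW W (wireSet (↑S : Set V)) ω)).real (⋃ t ∈ T, openConnIn (↑D : Set V) u₀ t) := by
        rw [← coe_pairsF]
        refine prodBernoulli_pinW_real_mono_of_inter W (pairsF S).finite_toSet.countable ω fun ω' ⟨hR', hcyl⟩ => ?_
        have hopen : ∀ e ∈ σ.seed x, e ∈ wireSet (↑S : Set V) → e ∈ ω' := fun e he heS =>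
          (hcyl e (by rw [coe_pairsF]; exact heS)).2 (hωA (Finset.mem_coe.2 he))
        obtain ⟨s₀, hs₀, t, ht, hst⟩ := mem_linkIn_iff.1 hR'
        have hus : ω' ∈ openConnIn (↑D : Set V) u₀ s₀ := hbox ω' hopen u₀ hu₀ s₀ hs₀
        have hst' : ω' ∈ openConnIn (↑D : Set V) s₀ t := by
          rw [DCT16.mem_openConnIn_iff_pathIn] at hst ⊢
          exact hst.mono (Finset.coe_subset.2 hQtD)
        exact Set.mem_biUnion (Finset.mem_coe.2 (hFtT ht)) (GM.openConnIn_trans hus hst')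
      exact lt_of_lt_of_le hωB (h1.trans h2)
    -- (b2) independence of `SeedOpen x` from the rest
    have hAdet : DeterminedBy (A x) (↑(σ.seed x) : Set (Sym2 V)) := σ.determinedBy_seedOpen x
    have hAm : MeasurableSet (A x) := σ.measurableSet_seedOpen x
    have hdisj_pick : (↑(σ.pick κ) : Set V).PairwiseDisjoint σ.seed := hσ.pick_disj κ hκK hκN
    have hNdet : DeterminedBy (Nκ κ x) (↑(σ.seed x) : Set (Sym2 V))ᶜ := by
      rw [determinedBy_iff]
      intro ω ω' hω
      simp only [hNκ, Set.mem_iInter, Set.mem_compl_iff]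
      refine forall₂_congr fun x' hx' => not_congr ?_
      obtain ⟨hx'sel, hlt⟩ := Finset.mem_filter.1 hx'
      have hne' : x' ≠ x := fun h => by rw [h] at hlt; exact lt_irrefl _ hlt
      have hdj : Disjoint (σ.seed x') (σ.seed x) := hdisj_pick (Finset.mem_coe.2 hx'sel) (Finset.mem_coe.2 hxsel) hne'
      refine σ.seedOpen_congr fun e he => ?_
      have heC : e ∈ (↑(σ.seed x) : Set (Sym2 V))ᶜ := fun h => Finset.disjoint_left.1 hdj he (Finset.mem_coe.1 h)
      have := Set.ext_iff.1 hω e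
      simp only [Set.mem_inter_iff] at this
      exact ⟨fun h' => (this.1 ⟨h', heC⟩).1, fun h' => (this.2 ⟨h', heC⟩).1⟩
    have hNm : MeasurableSet (Nκ κ x) := Finset.measurableSet_biInter _ fun x' _ => (σ.measurableSet_seedOpen x').compl
    have hRestDet : DeterminedBy (Bκ κ ∩ Nκ κ x ∩ Bad) (↑(σ.seed x) : Set (Sym2 V))ᶜ :=
      (((hBdet κ).mono (hreg_seed x hxK)).inter hNdet).inter
        (hBadF'.mono fun e he hex => (Finset.mem_sdiff.1 (Finset.mem_coe.1 he)).2 (Finset.mem_coe.1 hex))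
    have hRestm : MeasurableSet (Bκ κ ∩ Nκ κ x ∩ Bad) := ((hBm κ).inter hNm).inter hBadm
    have hind : μ.real (A x ∩ (Bκ κ ∩ Nκ κ x ∩ Bad)) = q x * μ.real (Bκ κ ∩ Nκ κ x ∩ Bad) := by
      rw [hq, hμ]
      exact prodBernoulli_real_inter_of_determinedBy W (σ.seed x) hAdet hRestDet hAm hRestm
    -- (b3) `μ(Bκ ∩ Nκ) = μ(Bκ) · P`
    have hN_eq : μ.real (Bκ κ ∩ Nκ κ x) = μ.real (Bκ κ) * P κ x := by
      have hsub : (↑((σ.pick κ).filter (fun x' => r x' < r x)) : Set V).PairwiseDisjoint σ.seed :=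
        hdisj_pick.subset (Finset.coe_subset.2 (Finset.filter_subset _ _))
      have hAκ : DeterminedBy (Bκ κ) (⋃ x' ∈ (σ.pick κ).filter (fun x' => r x' < r x), (↑(σ.seed x') : Set (Sym2 V)))ᶜ := by
        refine (hBdet κ).mono fun e he hmem => ?_
        simp only [Set.mem_iUnion, exists_prop] at hmem
        obtain ⟨x', hx', hex⟩ := hmem
        exact hreg_seed x' (hκK (hσ.pick_sub κ (Finset.mem_filter.1 hx').1)) he hex
      rw [hμ, hNκ, prodBernoulli_real_inter_biInter_of_determinedBy W _ σ.seed hsub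
        (fun x' _ => (σ.determinedBy_seedOpen x').compl) (fun x' _ => (σ.measurableSet_seedOpen x').compl) hAκ (hBm κ)]
      refine congrArg _ (Finset.prod_congr rfl fun x' _ => ?_)
      rw [measureReal_compl (σ.measurableSet_seedOpen x'), probReal_univ]
    -- (b4) `μ(Bκ ∩ Bad) = μ(Bκ) · μ(Bad)` and Markov `μ(Bad) ≤ δ²`
    have hB_eq : μ.real (Bκ κ ∩ Bad) = μ.real (Bκ κ) * μ.real Bad := by
      rw [Set.inter_comm, mul_comm, hμ]
      exact prodBernoulli_real_inter_of_determinedBy W F' hBadF' ((hBdet κ).mono (hreg_S F' hF'S)) hBadm (hBm κ)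
    have hBad : μ.real Bad ≤ δ ^ 2 := by
      have hM := prodBernoulli_real_pinLow_le' W F' hRm δ
      have h3' : 1 - (prodBernoulli W).real R ≤ δ ^ 3 := by linarith
      have : δ * μ.real Bad ≤ δ * δ ^ 2 := by rw [hμ]; nlinarith
      exact le_of_mul_le_mul_left this hδ
    -- (b5) assemble
    calc μ.real (Bκ κ ∩ A x ∩ Nκ κ x ∩ (Good x)ᶜ)
        ≤ μ.real (A x ∩ (Bκ κ ∩ Nκ κ x ∩ Bad)) := measureReal_mono (fun ω ⟨⟨⟨hB, hAω⟩, hN⟩, hG⟩ =>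
            ⟨hAω, ⟨hB, hN⟩, (hgood ⟨hAω, hG⟩).2⟩) (measure_ne_top _ _)
      _ = q x * μ.real (Bκ κ ∩ Nκ κ x ∩ Bad) := hind
      _ ≤ q x * min (μ.real (Bκ κ) * P κ x) (μ.real (Bκ κ) * δ ^ 2) := by
          refine mul_le_mul_of_nonneg_left (le_min ?_ ?_) measureReal_nonneg
          · rw [← hN_eq]; exact measureReal_mono Set.inter_subset_left (measure_ne_top _ _)
          · calc μ.real (Bκ κ ∩ Nκ κ x ∩ Bad) ≤ μ.real (Bκ κ ∩ Bad) :=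
                  measureReal_mono (Set.inter_subset_inter_left _ Set.inter_subset_left) (measure_ne_top _ _)
              _ = μ.real (Bκ κ) * μ.real Bad := hB_eq
              _ ≤ μ.real (Bκ κ) * δ ^ 2 := mul_le_mul_of_nonneg_left hBad measureReal_nonneg
      _ = μ.real (Bκ κ) * (q x * min (P κ x) (δ ^ 2)) := by rw [← mul_min_of_nonneg _ _ measureReal_nonneg]; ring
  -- the sum over the picked contacts of one contact set: the rank-truncation bound
  have hκsum : ∀ κ ∈ Ks, ∑ x ∈ σ.pick κ, μ.real (Bκ κ ∩ A x ∩ Nκ κ x ∩ (Good x)ᶜ) ≤ μ.real (Bκ κ) * (2 * δ) := by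
    intro κ hκ
    obtain ⟨hκK, -⟩ := Finset.mem_filter.1 hκ
    rw [Finset.mem_powerset] at hκK
    have hinj : Set.InjOn r ↑(σ.pick κ) := (rank_injOn σ.K).mono (Finset.coe_subset.2 ((hσ.pick_sub κ).trans hκK))
    have harith := sum_mul_min_prod_le r q (σ.pick κ) hinj (fun x _ => measureReal_nonneg) (fun x _ => measureReal_le_one)
      (sq_nonneg δ)
    rw [Real.sqrt_sq hδ.le] at harith
    calc ∑ x ∈ σ.pick κ, μ.real (Bκ κ ∩ A x ∩ Nκ κ x ∩ (Good x)ᶜ)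
        ≤ ∑ x ∈ σ.pick κ, μ.real (Bκ κ) * (q x * min (P κ x) (δ ^ 2)) := Finset.sum_le_sum (hterm κ hκ)
      _ = μ.real (Bκ κ) * ∑ x ∈ σ.pick κ, q x * min (P κ x) (δ ^ 2) := by rw [Finset.mul_sum]
      _ ≤ μ.real (Bκ κ) * (2 * δ) := mul_le_mul_of_nonneg_left harith measureReal_nonneg
  -- the contact-set events are pairwise disjoint
  have hdisjB : (↑Ks : Set (Finset V)).PairwiseDisjoint Bκ := by
    intro κ _ κ' _ hne
    exact Set.disjoint_left.2 fun ω h1 h2 => hne (h1.symm.trans h2)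
  calc μ.real (((L.Fail σ.N j)ᶜ ∩ L.Gev σ j) \ E)
      ≤ μ.real (⋃ κ ∈ Ks, ⋃ x ∈ σ.pick κ, (Bκ κ ∩ A x ∩ Nκ κ x ∩ (Good x)ᶜ)) := measureReal_mono hcov (measure_ne_top _ _)
    _ ≤ ∑ κ ∈ Ks, μ.real (⋃ x ∈ σ.pick κ, (Bκ κ ∩ A x ∩ Nκ κ x ∩ (Good x)ᶜ)) := measureReal_biUnion_finset_le _ _
    _ ≤ ∑ κ ∈ Ks, ∑ x ∈ σ.pick κ, μ.real (Bκ κ ∩ A x ∩ Nκ κ x ∩ (Good x)ᶜ) :=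
        Finset.sum_le_sum fun κ _ => measureReal_biUnion_finset_le _ _
    _ ≤ ∑ κ ∈ Ks, μ.real (Bκ κ) * (2 * δ) := Finset.sum_le_sum hκsum
    _ = (2 * δ) * μ.real (⋃ κ ∈ Ks, Bκ κ) := by
        rw [← Finset.sum_mul, mul_comm, measureReal_biUnion_finset hdisjB (fun κ _ => hBm κ)]
    _ ≤ (2 * δ) * 1 := mul_le_mul_of_nonneg_left measureReal_le_one (by linarith)
    _ = 2 * δ := mul_one _

end Forced

end KNLevels

end Transplant

end Summit.CriticalPhenomena.PercolationContinuityZ3.Theorems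

end
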